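import Mathlib
import Summits.NavierStokesRegularity.NavierStokesRegularity.Theorems.TaoLadderRungTwoBreakBlowupRigidityOneViscousFrontBundleLinks
import Summits.NavierStokesRegularity.NavierStokesRegularity.Theorems.TaoLadderRungTwoBreakBlowupRigidityOneMaximalExactFlow
import HarnessLib

/-!
# `stub_eternalFromBlowup` of K2(1) `TaoLadderRungTwoBreak.BlowupRigidityOne` (stmt-NavierStokesRegularity-20206) from a front
  hypothesis on the SMALL-VISCOSITY COMPANIONS of the blow-up — the objects robustness actually controls

MODEL lattice ODEs only (Tao 2016 §4 Thm. 4.2, (4.8), the viscous equation before Thm. 4.2, §6.4); nothing here is a statement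
about the Navier–Stokes equations; NO item is closed (`--supports stmt-NavierStokesRegularity-20206`).

Robust blow-up `NoGlobalCascade ε₀ α X₀` (`⟺ ∃κ>0 ¬HasGlobal`, `noGlobalCascade_iff_kappa`) says precisely that every
`ν`-viscous companion of the datum with `0 ≤ ν ≤ κ/√2` blows up in the (4.5) norm at a finite time
(`maximalViscousFlow_of_noGlobalCascade`, p815818/p816109 lineage); the tree's robustness consequences (never quiet, every high
shell exceeds every sub-(S₁) envelope, dissipation thresholds) are statements about THESE companions at `ν > 0`. This file
states the item's extraction half with the front hypothesis placed exactly there: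

* `stub_eternalFromBlowup_of_companionFronts` — if below a threshold, for every robust blow-up of a table `α ∈ E₂(R)` there is
  `κ' > 0` such that EVERY `ν`-viscous companion with `0 < ν ≤ κ'/√2` (C¹ on `[0,T)`, the datum at shell `0`, no shells
  below `0`, the viscous law, (4.5)-blow-up at `T`) carries an amplitude ceiling `B ν_r^j` at a STRICT ratio
  `(1+ε₀)⁻¹ < ν_r²`, floor times on the self-similar schedule (upper clock) and a pre-firing action bound, then the REGISTERED
  SIGNATURE of `stub_eternalFromBlowup` holds verbatim (take `ν = min(κ,κ')/√2 > 0`, the tree's maximal companion, then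
  `eternal_surviving_one_of_viscousFront`).

HONEST LABEL: conditional; the hypothesis (small-viscosity companions of robust blow-ups are strictly surviving fronts) is
OPEN and carries the item's content — robustness is known to force only the critical rate (`loudHighShells_of_noGlobalCascade`,
`companion_neverQuiet_of_noGlobalCascade`); no stub, crux or summit is proved here.
-/

noncomputable section

-- the summit and its single sub-problem share the name (CONVENTIONS §1)
set_option linter.dupNamespace false

open Set Filter Topology MeasureTheory

namespace Summit.NavierStokesRegularity.NavierStokesRegularity.Theorems

namespace BlowupRigidityOne

open Literature.Analysis.FluidPDE Literature.Analysis.FluidPDE.TaoCascade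

/-- **THE REGISTERED STUB `stub_eternalFromBlowup` FROM STRICT FRONTS ON THE SMALL-VISCOSITY COMPANIONS.** See the module
docstring. [cite: Tao2016AveragedNS, §4 Thm. 4.2 (statement shape), (4.8), the viscous equation before Thm. 4.2, Lemma 4.1 (4.5), (4.7), (4.11), §6.4; KochNadirashviliSereginSverak2009, Thm 1.1 ff.; Teschl2012, §2.6 Cor. 2.16; cell vocabulary (`NoGlobalCascade`, `IsEternal`, `EternalSurvivingFwd`)] -/
theorem stub_eternalFromBlowup_of_companionFronts
    (H : ∀ R : ℝ, 1 ≤ R → ∃ εs : ℝ, 0 < εs ∧ ∀ ε₀ : ℝ, 0 < ε₀ → ε₀ ≤ εs →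
      ∀ (α : (Fin 4 → Fin 4 → Fin 4 → ℤ × ℤ × ℤ → ℝ)) (X₀ : Fin 4 → ℝ),
        InTableClass R α → NoGlobalCascade ε₀ α X₀ →
        ∃ κ' : ℝ, 0 < κ' ∧ ∀ (ν T : ℝ) (X : Fin 4 → ℤ → ℝ → ℝ), 0 < ν → ν * Real.sqrt 2 ≤ κ' → 0 < T →
          (∀ i n, ContDiffOn ℝ 1 (X i n) (Set.Ico 0 T)) →
          (∀ i n, X i n 0 = if n = 0 then X₀ i else 0) →
          (∀ i n t, n < 0 → X i n t = 0) →
          (∀ i n t, 0 ≤ t → t < T → derivWithin (X i n) (Set.Ici 0) t =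
            quadTerm ε₀ α X i n t - ν * (1 + ε₀) ^ ((2 : ℝ) * n) * X i n t) →
          (∀ M : ℝ, ∃ t : ℝ, 0 ≤ t ∧ t < T ∧
            ∃ (i : Fin 4) (n : ℤ), M < (1 + (1 + ε₀) ^ ((10 : ℝ) * n)) * |X i n t|) →
          ∃ (A' B νr cf κ₂ : ℝ) (t : ℕ → ℝ),
            0 < νr ∧ (1 + ε₀)⁻¹ < νr ^ 2 ∧
            (∀ (j : ℤ) (s : ℝ), 0 ≤ s → s < T → ‖shellVec X j s‖ ≤ B * νr ^ j) ∧
            0 < cf ∧ 0 < κ₂ ∧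
            (∀ k : ℕ, 0 ≤ t k ∧ t k < T ∧ cf * (νr ^ 2) ^ k ≤ ‖shellVec X (k : ℤ) (t k)‖ ^ 2 ∧
              (bigLam ε₀ ^ 2 * νr ^ 2) ^ k * (T - t k) ^ 2 ≤ κ₂) ∧
            (∀ k : ℕ, bigLam ε₀ ^ (k : ℤ) * (∫ s in (0 : ℝ)..t k, ‖shellVec X (k : ℤ) s‖) ≤ A')) :
    ∀ R : ℝ, 1 ≤ R → ∃ εs : ℝ, 0 < εs ∧ ∀ ε₀ : ℝ, 0 < ε₀ → ε₀ ≤ εs →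
      ∀ (α : (Fin 4 → Fin 4 → Fin 4 → ℤ × ℤ × ℤ → ℝ)) (X₀ : Fin 4 → ℝ),
        Literature.Analysis.FluidPDE.TaoCascade.InTableClass R α →
        Literature.Analysis.FluidPDE.TaoCascade.NoGlobalCascade ε₀ α X₀ →
        ∃ W : ℤ → ℝ → Literature.Analysis.FluidPDE.TaoCascade.Em 4,
          Literature.Analysis.FluidPDE.TaoCascade.IsEternal ε₀ α W ∧
          Literature.Analysis.FluidPDE.TaoCascade.EternalSurvivingFwd 1 ε₀ W := by
  intro R hR
  obtain ⟨εs, hεs, hH⟩ := H R hR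
  refine ⟨εs, hεs, fun ε₀ hε hεle α X₀ hα hNG => ?_⟩
  obtain ⟨κ', hκ', hfront⟩ := hH ε₀ hε hεle α X₀ hα hNG
  obtain ⟨κ, hκ, hflow⟩ := maximalViscousFlow_of_noGlobalCascade hε hα hNG
  -- a positive admissible viscosity below both thresholds
  have hs2 : 0 < Real.sqrt 2 := Real.sqrt_pos.2 two_pos
  set ν : ℝ := min κ κ' / Real.sqrt 2 with hν_def
  have hmin : 0 < min κ κ' := lt_min hκ hκ'
  have hν0 : 0 < ν := div_pos hmin hs2
  have hνs : ν * Real.sqrt 2 = min κ κ' := by rw [hν_def]; field_simp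
  have hνκ : ν * Real.sqrt 2 ≤ κ := by rw [hνs]; exact min_le_left _ _
  have hνκ' : ν * Real.sqrt 2 ≤ κ' := by rw [hνs]; exact min_le_right _ _
  obtain ⟨T, X, hT, hC1, hinit, hlow, hmot, -, hblow⟩ := hflow ν hν0.le hνκ
  obtain ⟨A', B, νr, cf, κ₂, t, hνr, hν1, hamp, hcf, hκ₂, hfire, hpre⟩ :=
    hfront ν T X hν0 hνκ' hT hC1 hinit hlow hmot hblow
  -- the full action from the pre-firing bound (post-firing part free; shells below `0` carry nothing)
  have hcont : ∀ k : ℤ, ContinuousOn (fun s => shellVec X k s) (Ico 0 T) := fun k =>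
    continuousOn_shellVec_of_contDiffOn hC1 k
  have hneg : ∀ k : ℤ, k < 0 → ∀ s, shellVec X k s = 0 := fun k hk s => by
    ext i; simp [shellVec, hlow i k s hk]
  have hact : ∀ k : ℤ, IntegrableOn (fun s => ‖shellVec X k s‖) (Ico 0 T) ∧
      bigLam ε₀ ^ k * (∫ s in Ico 0 T, ‖shellVec X k s‖) ≤ max (A' + B * Real.sqrt κ₂) 0 := by
    intro k
    rcases lt_or_ge k 0 with hk | hk
    · refine ⟨?_, ?_⟩
      · refine (integrableOn_zero).congr_fun (fun s _ => ?_) measurableSet_Ico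
        simp only [hneg k hk s, norm_zero]
      · have : ∫ s in Ico 0 T, ‖shellVec X k s‖ = 0 := by
          rw [setIntegral_congr_fun measurableSet_Ico (fun s _ => by rw [hneg k hk s, norm_zero])]
          simp
        rw [this, mul_zero]
        exact le_max_right _ _
    · obtain ⟨n, rfl⟩ := Int.eq_ofNat_of_zero_le hk
      obtain ⟨ht0, htT, -, hclock⟩ := hfire n
      obtain ⟨hint, hle⟩ := action_le_prefiring_add hε hcont hamp n ht0 htT hclock
      exact ⟨hint, (hle.trans (by linarith [hpre n])).trans (le_max_left _ _)⟩
  exact eternal_surviving_one_of_viscousFront hε hT hν0.le hC1 hmot hact hνr hν1 hamp hcf hκ₂ fun k =>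
    let ⟨ht0, htT, hfl, hclock⟩ := hfire k
    ⟨t k, ht0, htT, hfl, hclock⟩

end BlowupRigidityOne

end Summit.NavierStokesRegularity.NavierStokesRegularity.Theorems

end
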